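import Literature.NumberTheory.BeurlingPrimes.BDTowerPositivity
import Literature.NumberTheory.BeurlingPrimes.WellBehavedSystemsProofs
import Literature.NumberTheory.BeurlingPrimes.BVContinuation
import Literature.NumberTheory.BeurlingPrimes.LiAbel
import Literature.NumberTheory.BeurlingPrimes.LiSeries
import HarnessLib

/-!
# The Broucke–Debruyne tower template as a Stieltjes function; the random primes (BV Theorem 1.2)

Topic `Literature/NumberTheory/BeurlingPrimes`, grouping namespace `BDTower` (objects `BDTowerTemplate.lean`, positivity
`BDTowerPositivity.lean`). Everything in this file is PROVED; the only deep input is Broucke–Vindas 2024 Theorem 1.2,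
PROVED in the tree (`BrouckeVindas2024_thm12_holds`).

Broucke–Debruyne 2023 §6 (arXiv:2211.08716 pp. 15–16): "We first define a continuous system through its zeta function
and then extract a discrete system via a probabilistic approximation procedure … following a suitable probabilistic
discretization procedure, e.g. [BrouckeVindas] …". Here, exactly as the tree does for BDR §4
(`WellBehavedSystemsSec4Proofs`, `tmpl`, `tmplS`, `exists_sysData`):

* `densCut Θ = 1_{(1,∞)} · primeDensity Θ` — the BV density (`0 ≤ densCut ≤ 2`, measurable);
* `towerF Θ x = ∫₁ˣ densCut`, non-decreasing, continuous, `= 0` on `(−∞,1]`, `Li/2 ≤ towerF ≤ 3Li/2` on `[1,∞)`,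
  `towerF → ∞`, `towerF(x) ≤ 3x/log x`; the Stieltjes function `towerS`, `d(towerS) = densCut du`,
  `∫_{[1,x]} u^{−it} d(towerS) = BV.tmplSum densCut x t`;
* `exists_approx` — **the discrete primes**: `∃ P A, BV.Approx (densCut Θ) P A ∧ |π_P − towerF| ≤ 2`.

## References
* [BrouckeDebruyne2023] F. Broucke, G. Debruyne, Acta Arith. 207 (2023), §6 (read).
* [BrouckeVindas2024] F. Broucke, J. Vindas, Math. Z. 307 (2024), Theorem 1.2 (tree, proved).
-/

noncomputable section

open Filter Topology Set MeasureTheory intervalIntegral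
open scoped ENNReal NNReal

namespace Literature.NumberTheory.BeurlingPrimes

namespace BDTower

variable {Θ : ℝ}

/-! ### The cut-off density -/

/-- The BV density of the tower template: `primeDensity` on `(1,∞)`, `0` elsewhere. [cite: BrouckeDebruyne2023, §6] -/
def densCut (Θ : ℝ) (u : ℝ) : ℝ := if 1 < u then primeDensity Θ u else 0

/-- `densCut = primeDensity` on `(1,∞)`. [cite: BrouckeDebruyne2023, §6] -/
theorem densCut_of_one_lt {u : ℝ} (hu : 1 < u) : densCut Θ u = primeDensity Θ u := if_pos hu

/-- `densCut = 0` on `(−∞,1]`. [cite: BrouckeDebruyne2023, §6] -/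
theorem densCut_of_le_one {u : ℝ} (hu : u ≤ 1) : densCut Θ u = 0 := if_neg (not_lt.mpr hu)

/-- `densCut` is the indicator of `(1,∞)` applied to (the `(0,∞)`-indicator of) `primeDensity`. [cite: BrouckeDebruyne2023, §6] -/
theorem densCut_eq_indicator (Θ : ℝ) :
    densCut Θ = (Ioi (1 : ℝ)).indicator (fun v ↦ (Ioi (0 : ℝ)).indicator (primeDensity Θ) v) := by
  funext u
  by_cases hu : 1 < u
  · have hu0 : u ∈ Ioi (0 : ℝ) := lt_trans one_pos hu
    rw [densCut_of_one_lt hu, indicator_of_mem (show u ∈ Ioi (1 : ℝ) from hu), indicator_of_mem hu0]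
  · rw [densCut_of_le_one (not_lt.mp hu), indicator_of_notMem (show u ∉ Ioi (1 : ℝ) from hu)]

/-- `densCut` is measurable. [cite: BrouckeDebruyne2023, §6] -/
theorem measurable_densCut (hΘ1 : Θ < 1) : Measurable (densCut Θ) := by
  rw [densCut_eq_indicator]
  exact (measurable_primeDensity_indicator hΘ1).indicator measurableSet_Ioi

/-- `densCut ≥ 0`. [cite: BrouckeDebruyne2023, §6 ("dΠ is indeed a positive measure")] -/
theorem densCut_nonneg (hΘ : 1 / 2 < Θ) (hΘ1 : Θ < 1) (u : ℝ) : 0 ≤ densCut Θ u := by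
  by_cases hu : 1 < u
  · rw [densCut_of_one_lt hu]; exact primeDensity_nonneg hΘ hΘ1 hu
  · rw [densCut_of_le_one (not_lt.mp hu)]

/-- `|densCut| ≤ 2`. [cite: BrouckeDebruyne2023, §6] -/
theorem abs_densCut_le_two (hΘ : 1 / 2 < Θ) (hΘ1 : Θ < 1) (u : ℝ) : |densCut Θ u| ≤ 2 := by
  rw [abs_of_nonneg (densCut_nonneg hΘ hΘ1 u)]
  by_cases hu : 1 < u
  · rw [densCut_of_one_lt hu]; exact primeDensity_le_two hΘ hΘ1 hu
  · rw [densCut_of_le_one (not_lt.mp hu)]; norm_num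

/-- `|densCut| ≤ 2` on `(1,∞)` (the form used by the BV continuation). [cite: BrouckeDebruyne2023, §6] -/
theorem abs_densCut_le_two' (hΘ : 1 / 2 < Θ) (hΘ1 : Θ < 1) : ∀ v : ℝ, 1 < v → |densCut Θ v| ≤ 2 :=
  fun v _ ↦ abs_densCut_le_two hΘ hΘ1 v

/-- Comparison with the `Li` integrand on `[1,∞)`: `densCut u ≤ 3/2 · (1 − u⁻¹)/log u`. [cite: BrouckeDebruyne2023, §6] -/
theorem densCut_le_Li_integrand (hΘ : 1 / 2 < Θ) (hΘ1 : Θ < 1) {u : ℝ} (hu : 1 ≤ u) :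
    densCut Θ u ≤ 3 / 2 * ((1 - u⁻¹) / Real.log u) := by
  rcases hu.eq_or_lt with rfl | hu1
  · rw [densCut_of_le_one le_rfl]; norm_num
  · rw [densCut_of_one_lt hu1, show (1 - u⁻¹) / Real.log u = DMV.poleDensity u by rw [DMV.poleDensity, one_div]]
    exact (primeDensity_bounds hΘ hΘ1 hu1).2

/-- … and `(1 − u⁻¹)/(2 log u) ≤ densCut u`. [cite: BrouckeDebruyne2023, §6] -/
theorem Li_integrand_le_densCut (hΘ : 1 / 2 < Θ) (hΘ1 : Θ < 1) {u : ℝ} (hu : 1 ≤ u) :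
    1 / 2 * ((1 - u⁻¹) / Real.log u) ≤ densCut Θ u := by
  rcases hu.eq_or_lt with rfl | hu1
  · rw [densCut_of_le_one le_rfl]; norm_num
  · rw [densCut_of_one_lt hu1, show (1 - u⁻¹) / Real.log u = DMV.poleDensity u by rw [DMV.poleDensity, one_div]]
    linarith [(primeDensity_bounds hΘ hΘ1 hu1).1]

/-! ### The template `towerF = ∫₁ densCut` -/

/-- **The template** `F(x) = ∫₁ˣ densCut` (BD's `Π` of the continuous system, used as BV's `F`).
[cite: BrouckeDebruyne2023, §6] -/
def towerF (Θ : ℝ) (x : ℝ) : ℝ := ∫ u in (1 : ℝ)..x, densCut Θ u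

/-- `densCut` is integrable on sets of finite measure. [cite: BrouckeDebruyne2023, §6] -/
theorem integrableOn_densCut (hΘ : 1 / 2 < Θ) (hΘ1 : Θ < 1) {S : Set ℝ} (hS : volume S < ⊤) :
    IntegrableOn (densCut Θ) S := by
  refine Measure.integrableOn_of_bounded (M := 2) hS.ne (measurable_densCut hΘ1).aestronglyMeasurable ?_
  exact Eventually.of_forall fun u ↦ by rw [Real.norm_eq_abs]; exact abs_densCut_le_two hΘ hΘ1 u

/-- `densCut` is interval integrable. [cite: BrouckeDebruyne2023, §6] -/
theorem intervalIntegrable_densCut (hΘ : 1 / 2 < Θ) (hΘ1 : Θ < 1) (a b : ℝ) :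
    IntervalIntegrable (densCut Θ) volume a b :=
  intervalIntegrable_iff.mpr (integrableOn_densCut hΘ hΘ1 measure_Ioc_lt_top)

/-- `∫ₐᵇ densCut = F(b) − F(a)`. [cite: BrouckeDebruyne2023, §6] -/
theorem integral_densCut_eq (hΘ : 1 / 2 < Θ) (hΘ1 : Θ < 1) (a b : ℝ) :
    ∫ u in a..b, densCut Θ u = towerF Θ b - towerF Θ a := by
  unfold towerF
  rw [integral_interval_sub_left (intervalIntegrable_densCut hΘ hΘ1 1 b) (intervalIntegrable_densCut hΘ hΘ1 1 a)]

/-- `F(1) = 0`. [cite: BrouckeDebruyne2023, §6] -/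
theorem towerF_one (Θ : ℝ) : towerF Θ 1 = 0 := by simp [towerF]

/-- `F = 0` on `(−∞,1]`. [cite: BrouckeDebruyne2023, §6] -/
theorem towerF_of_le_one {x : ℝ} (hx : x ≤ 1) : towerF Θ x = 0 := by
  unfold towerF
  refine integral_zero_ae (Eventually.of_forall fun u hu ↦ densCut_of_le_one ?_)
  rw [uIoc_of_ge hx] at hu
  exact hu.2

/-- `F` is non-decreasing. [cite: BrouckeDebruyne2023, §6] -/
theorem towerF_mono (hΘ : 1 / 2 < Θ) (hΘ1 : Θ < 1) : Monotone (towerF Θ) := by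
  intro x y hxy
  have := integral_densCut_eq hΘ hΘ1 x y
  have h0 : 0 ≤ ∫ u in x..y, densCut Θ u := integral_nonneg hxy fun u _ ↦ densCut_nonneg hΘ hΘ1 u
  linarith

/-- `F ≥ 0`. [cite: BrouckeDebruyne2023, §6] -/
theorem towerF_nonneg (hΘ : 1 / 2 < Θ) (hΘ1 : Θ < 1) (x : ℝ) : 0 ≤ towerF Θ x := by
  rcases le_or_gt x 1 with hx | hx
  · rw [towerF_of_le_one hx]
  · rw [← towerF_one Θ]; exact towerF_mono hΘ hΘ1 hx.le

/-- `F` is continuous. [cite: BrouckeDebruyne2023, §6] -/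
theorem continuous_towerF (hΘ : 1 / 2 < Θ) (hΘ1 : Θ < 1) : Continuous (towerF Θ) :=
  continuous_primitive (intervalIntegrable_densCut hΘ hΘ1) 1

/-- `Li(x)/2 ≤ F(x) ≤ 3Li(x)/2` for `x ≥ 1`. [cite: BrouckeDebruyne2023, §6] -/
theorem towerF_bounds (hΘ : 1 / 2 < Θ) (hΘ1 : Θ < 1) {x : ℝ} (hx : 1 ≤ x) :
    Li x / 2 ≤ towerF Θ x ∧ towerF Θ x ≤ 3 / 2 * Li x := by
  have hi := intervalIntegrable_Li_integrand hx
  have hd := intervalIntegrable_densCut hΘ hΘ1 1 x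
  constructor
  · have h := intervalIntegral.integral_mono_on hx (hi.const_mul (1 / 2)) hd
      fun u hu ↦ Li_integrand_le_densCut hΘ hΘ1 hu.1
    rw [intervalIntegral.integral_const_mul] at h
    unfold towerF; unfold Li at *; linarith
  · have h := intervalIntegral.integral_mono_on hx hd (hi.const_mul (3 / 2))
      fun u hu ↦ densCut_le_Li_integrand hΘ hΘ1 hu.1
    rw [intervalIntegral.integral_const_mul] at h
    unfold towerF; unfold Li; exact h

/-- `F → ∞` (`F ≥ Li/2 ≥ li/2`). [cite: BrouckeDebruyne2023, §6] -/
theorem tendsto_towerF_atTop (hΘ : 1 / 2 < Θ) (hΘ1 : Θ < 1) : Tendsto (towerF Θ) atTop atTop := by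
  have h1 : Tendsto (fun x ↦ li x / 2) atTop atTop := tendsto_li_atTop.atTop_div_const (by norm_num)
  refine tendsto_atTop_mono' _ ?_ h1
  filter_upwards [eventually_ge_atTop (1 : ℝ)] with x hx
  exact le_trans (by linarith [li_le_Li hx]) (towerF_bounds hΘ hΘ1 hx).1

/-- The Chebyshev bound `F(x) ≤ 3x/log x` for `x ≥ 2`. [cite: BrouckeDebruyne2023, §6] -/
theorem towerF_chebyshev (hΘ : 1 / 2 < Θ) (hΘ1 : Θ < 1) :
    ∃ C : ℝ, ∀ x : ℝ, 2 ≤ x → towerF Θ x ≤ C * x / Real.log x := by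
  refine ⟨3, fun x hx ↦ ?_⟩
  have hx1 : (1 : ℝ) < x := by linarith
  have h1 := (towerF_bounds hΘ hΘ1 hx1.le).2
  have h2 : Li x ≤ 2 * x / Real.log x := Li_le hx1
  calc towerF Θ x ≤ 3 / 2 * Li x := h1
    _ ≤ 3 / 2 * (2 * x / Real.log x) := by gcongr
    _ = 3 * x / Real.log x := by ring

/-! ### The Stieltjes function and the template side of (1.3) -/

/-- `F` as a Stieltjes function. [cite: BrouckeVindas2024, Theorem 1.2] -/
def towerS (hΘ : 1 / 2 < Θ) (hΘ1 : Θ < 1) : StieltjesFunction ℝ where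
  toFun := towerF Θ
  mono' := towerF_mono hΘ hΘ1
  right_continuous' _ := (continuous_towerF hΘ hΘ1).continuousWithinAt

/-- The Stieltjes function is `F`. [cite: BrouckeVindas2024, Theorem 1.2] -/
theorem towerS_apply (hΘ : 1 / 2 < Θ) (hΘ1 : Θ < 1) (x : ℝ) : towerS hΘ hΘ1 x = towerF Θ x := rfl

/-- **`dF = densCut du`.** [cite: BrouckeVindas2024, Theorem 1.2] -/
theorem towerS_measure (hΘ : 1 / 2 < Θ) (hΘ1 : Θ < 1) :
    (towerS hΘ hΘ1).measure = volume.withDensity fun u ↦ ENNReal.ofReal (densCut Θ u) := by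
  refine Measure.ext_of_Ioc _ _ fun a b hab ↦ ?_
  rw [StieltjesFunction.measure_Ioc, withDensity_apply _ measurableSet_Ioc, towerS_apply, towerS_apply,
    ← ofReal_integral_eq_lintegral_ofReal (integrableOn_densCut hΘ hΘ1 measure_Ioc_lt_top)
      (Eventually.of_forall fun u ↦ densCut_nonneg hΘ hΘ1 u),
    ← intervalIntegral.integral_of_le hab.le, integral_densCut_eq hΘ hΘ1]

/-- **The template side of (1.3)**: `∫_{[1,x]} u^{−it} dF(u) = BV.tmplSum densCut x t` (`x ≥ 1`).
[cite: BrouckeVindas2024, Theorem 1.2] -/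
theorem stieltjesExpSum_towerS (hΘ : 1 / 2 < Θ) (hΘ1 : Θ < 1) {x : ℝ} (hx : 1 ≤ x) (t : ℝ) :
    stieltjesExpSum (towerS hΘ hΘ1) x t = BV.tmplSum (densCut Θ) x t := by
  rw [stieltjesExpSum, towerS_measure]
  have hdens : (fun u ↦ ENNReal.ofReal (densCut Θ u)) = fun u ↦ ((Real.toNNReal (densCut Θ u) : NNReal) : ENNReal) := rfl
  rw [hdens, setIntegral_withDensity_eq_setIntegral_smul (measurable_densCut hΘ1).real_toNNReal _ measurableSet_Icc,
    integral_Icc_eq_integral_Ioc, BV.tmplSum, intervalIntegral.integral_of_le hx]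
  refine setIntegral_congr_fun measurableSet_Ioc fun u _ ↦ ?_
  rw [BV.tmplIntegrand, NNReal.smul_def, Real.coe_toNNReal _ (densCut_nonneg hΘ hΘ1 u), Complex.real_smul]

/-! ### The discrete primes (BV Theorem 1.2) -/

/-- **The random primes of the tower template**: a Beurling system `P` with `|π_P − F| ≤ 2` and the exponential-sum
approximation (1.3) for the density `densCut` (BD §6: "following a suitable probabilistic discretization procedure";
tree `BrouckeVindas2024_thm12_holds`). [cite: BrouckeDebruyne2023, §6] -/
theorem exists_approx (hΘ : 1 / 2 < Θ) (hΘ1 : Θ < 1) :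
    ∃ (P : Literature.Barriers.RiemannHypothesis.BeurlingPrimes) (A : ℝ),
      BV.Approx (densCut Θ) P A ∧ ∀ x : ℝ, |(P.primeCount x : ℝ) - towerF Θ x| ≤ 2 := by
  obtain ⟨⟨P, hπ, A, hA⟩, -⟩ := BrouckeVindas2024_thm12_holds (towerS hΘ hΘ1) (towerF_one Θ)
    (towerF_nonneg hΘ hΘ1) (tendsto_towerF_atTop hΘ hΘ1) (towerF_chebyshev hΘ hΘ1)
  refine ⟨P, A, fun x hx t ↦ ?_, fun x ↦ hπ x⟩
  have := hA t x hx
  rwa [stieltjesExpSum_towerS hΘ hΘ1 hx t] at this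

end BDTower

end Literature.NumberTheory.BeurlingPrimes

end
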